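/-
Copyright (c) 2026. All rights reserved.
Released under Apache 2.0 license as described in the file LICENSE.
Authors: abc-iut cell, prover seat abc-iut-c312-5 (Cor. 3.12 sub-crew, gen 7).
-/
import Literature.IUT.LogVolume.TensorPacketDifferentSharp
import HarnessLib

/-!
# The CONDUCTOR of `R_I` in `(R_I)^∼` is exactly `∏_J 𝔭_J^{e_J(d_I − d_{L_J})}` ([IUTchIV] Prop. 1.1 as an EQUIVALENCE),
# and boxes `u·(R_I)^∼` inside the tensor log-shell `⊗ log_p(R_i^×)` (Dupuy–Hilado §4.9–4.12)

abc-iut cell, seat abc-iut-c312-5 (D-0079 sub-cell R-W «WINDOW Θ-SIDE INEQUALITY», lane U, task T2 «structure of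
`log_p(𝒪^×)` at non-tame places and the hull of the (Ind1)(Ind2)-orbit», part 1 of 2 — part 2 is
`TensorPacketContentExact.lean`).  PROOF-ONLY file (no definitions, no named `Prop` facts); classical lattice algebra
over the cell's REAL definitions (`PacketAlgebra`, `integerPacket` = `R_I`, `normalizedPacket` = `(R_I)^∼`, `logPacket` =
`log_p(R_I^×) := ⊗ log_p(R_i^×)`, `dEquiv` = `ψ : V ≅ ∏_J L_J`, `different`, `differentOrd`, `dSum` = `d_I`).  Sequel of
abc-iut-w6-d018's `TensorPacketDifferentSharp` (the sharp converse of [IUTchIV] Prop. 1.1: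
`u·(R_I)^∼ ⊆ R_I ⇒ ‖ψ_J(u)‖ ≤ p^{−(d_I − d_{L_J})}` at every factor `L_J`).

* §1 `repr_piTensorProduct_eq_trace_mul` — the tensor basis `⊗b^{(i)}` of integral bases and the pure tensors
  `⊗c^{(i)}` of their trace duals are a DUAL PAIR for `Tr_{V/ℚ_p}` (`Tr_V(⊗x_i·⊗y_i) = ∏ Tr_{k_i}(x_i y_i)`):
  the `J`-th coordinate of `v` is `Tr_V(v·⊗_i c^{(i)}_{J_i})`.
* §2 **`smul_normalizedPacket_subset_integerPacket_of_norm_dEquiv_le`** — the CONVERSE of abc-iut-w6-d018's sharp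
  converse: `‖ψ_J(w)‖ ≤ p^{−(d_I − d_{L_J})}` at every `J` ⇒ `w·(R_I)^∼ ⊆ R_I`.  So the conductor of the order `R_I`
  in its normalisation `(R_I)^∼ ≅ ∏ O_{L_J}` is EXACTLY `{w : ∀ J, ‖ψ_J(w)‖ ≤ p^{−(d_I − d_{L_J})}}`
  (`smul_normalizedPacket_subset_integerPacket_iff`; [IUTchIV] Prop. 1.1 exhibits the element `⊗_{i≠*}δ_i` of it).
  Proof: read the `⊗b`-coordinates of `w·r` as `Tr_V(w·r·⊗c^{(i)}) = Σ_J Tr_{L_J}(ψ_J(w·⊗δ_i⁻¹)·ψ_J(s))`,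
  `s = r·⊗(δ_i c^{(i)}) ∈ (R_I)^∼` (`δ_i c^{(i)}_j ∈ R_i`: the definition of the different), and
  `ψ_J(w·⊗δ_i⁻¹)·ψ_J(s) ∈ 𝔇_{L_J}⁻¹`.
* §3 the LOG-SHELL versions: `smul_normalizedPacket_subset_logPacket_of_norm_dEquiv_le` — for inner balls
  `c_i·R_i ⊆ log_p(R_i^×)`: `‖ψ_J(u)‖ ≤ p^{−(d_I − d_{L_J})}·∏‖c_i‖` at every `J` ⇒ `u·(R_I)^∼ ⊆ log_p(R_I^×)`
  (`u = ⊗c_i · u'` with `u'` in the conductor; [IUTchIV] Prop. 1.2 (ii) is the case `‖c_i‖ = p^{−a_i}`); and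
  `norm_dEquiv_mul_prod_le_of_smul_normalizedPacket_subset_logPacket` — `u·(R_I)^∼ ⊆ log_p(R_I^×)` and trace-dual
  test elements `y_i` (`Tr_{k_i}(y_i·log_p(R_i^×)) ⊆ ℤ_p`) ⇒ `‖ψ_J(u)‖·∏‖y_i‖ ≤ p^{d_{L_J}}` (abc-iut-w6-d018's test
  `ψ⁻¹(0,…,o,…,0)` against `Tr_V(·⊗y_i)`).  Part 2 supplies test elements of norm `(‖δ_i‖·ρ_in)⁻¹` at the INNER
  RADIUS `ρ_in` of each factor shell and concludes the exact content criterion.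

Classical (Dedekind: the conductor of an order and the quotient of differents; Serre, *Corps locaux* III §3, §6;
Weil, *Basic Number Theory* II §2 Th. 1); the tags record the cell's typing of [IUTchIV] §1.
[cite: Mochizuki2012, IUTchIV Prop. 1.1 p. 9, Prop. 1.2 (i)(ii) p. 10] [cite: DupuyHilado2025, §4.9, §4.12]
[cite: WeilBNT1967, Ch. II §2, Th. 1] No side taken on [IUTchIII] Cor. 3.12 [claim: Mochizuki2012, status: disputed].
-/

noncomputable section

open Set Module Function
open scoped Pointwise TensorProduct NormedField nonZeroDivisors

namespace Literature.IUT.LogVolume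

/-! ## 1. The tensor basis of integral bases and the pure tensors of their trace duals are a dual pair -/

section DualPair

variable (p : ℕ) [Fact p.Prime]
variable {I : Type} [Fintype I] [DecidableEq I]
variable (k : I → Type) [∀ i, NontriviallyNormedField (k i)] [∀ i, NormedAlgebra ℚ_[p] (k i)]
  [∀ i, IsUltrametricDist (k i)] [∀ i, ProperSpace (k i)]
variable {κ : I → Type} [∀ i, DecidableEq (κ i)]
  (bQ cQ : Π i, Basis (κ i) ℚ_[p] (k i))
  (hc : ∀ i a b, Algebra.trace ℚ_[p] (k i) (cQ i a * bQ i b) = if b = a then 1 else 0)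

omit [DecidableEq I] in
include hc in
/-- **Tensor dual pair.** For trace-dual pairs `(b^{(i)}, c^{(i)})` of bases of the `k_i`, the `J`-th coordinate of
`v ∈ V = ⊗ k_i` in the tensor basis `⊗ b^{(i)}` is `Tr_{V/ℚ_p}(v · ⊗_i c^{(i)}_{J_i})`
(`Tr_V(⊗x_i · ⊗y_i) = ∏_i Tr_{k_i}(x_i y_i)`). [cite: Mochizuki2012, IUTchIV Prop. 1.1 p. 9] -/
theorem repr_piTensorProduct_eq_trace_mul (v : PacketAlgebra p k) (J : Π i, κ i) :
    (Basis.piTensorProduct bQ).repr v J =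
      Algebra.trace ℚ_[p] (PacketAlgebra p k) (v * purePacket p k fun i => cQ i (J i)) := by
  classical
  set B := Basis.piTensorProduct bQ with hB
  -- two linear functionals agreeing on the basis `B`
  let f : PacketAlgebra p k →ₗ[ℚ_[p]] ℚ_[p] :=
    (Algebra.trace ℚ_[p] (PacketAlgebra p k)).comp
      (LinearMap.mulRight ℚ_[p] (purePacket p k fun i => cQ i (J i)))
  have hf : ∀ w, f w = Algebra.trace ℚ_[p] (PacketAlgebra p k) (w * purePacket p k fun i => cQ i (J i)) :=
    fun w => rfl
  have hfg : f = B.coord J := by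
    refine B.ext fun J' => ?_
    rw [hf, Basis.coord_apply, Basis.repr_self, Finsupp.single_apply, hB, Basis.piTensorProduct_apply,
      show (⨂ₜ[ℚ_[p]] i, (bQ i) (J' i)) = purePacket p k (fun i => bQ i (J' i)) from rfl, purePacket_mul,
      trace_purePacket]
    have hfac : ∀ i, Algebra.trace ℚ_[p] (k i) (((fun i => bQ i (J' i)) * fun i => cQ i (J i)) i) =
        if J' i = J i then 1 else 0 := fun i => by
      rw [Pi.mul_apply, mul_comm, hc]
    simp_rw [hfac]
    rw [Finset.prod_boole]
    by_cases hJ : J' = J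
    · subst hJ; simp
    · rw [if_neg hJ, if_neg]
      intro hall
      exact hJ (funext fun i => hall i (Finset.mem_univ i))
  rw [← Basis.coord_apply, ← hfg, hf]

end DualPair

/-! ## 2. The conductor of `R_I` in `(R_I)^∼` is exactly `∏_J 𝔭_J^{e_J (d_I − d_{L_J})}` -/

section Conductor

variable (p : ℕ) [Fact p.Prime]
variable {I : Type} [Fintype I] [DecidableEq I] [Nonempty I]
variable (k : I → Type) [∀ i, NontriviallyNormedField (k i)] [∀ i, NormedAlgebra ℚ_[p] (k i)]
  [∀ i, IsUltrametricDist (k i)] [∀ i, ProperSpace (k i)]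

/-- `‖ψ_J(s)‖ ≤ 1` for `s ∈ (R_I)^∼` (`ψ((R_I)^∼)` is the unit polydisc). [cite: Mochizuki2012, IUTchIV Prop. 1.4 (i) p. 13] -/
private theorem norm_dEquiv_le_one_of_mem_normalizedPacket' {s : PacketAlgebra p k} (hs : s ∈ normalizedPacket p k)
    (J : DIdx p k) : ‖dEquiv p k s J‖ ≤ 1 := by
  have h : dEquiv p k s ∈ dEquiv p k '' (normalizedPacket p k : Set (PacketAlgebra p k)) :=
    Set.mem_image_of_mem _ hs
  rw [image_normalizedPacket_eq_coe, coe_piUnitBallStructure, mem_polydisc] at h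
  exact h J

omit [Nonempty I] in
/-- `‖ψ_J(⊗δ_i⁻¹)‖ = p^{d_I}` for generators `δ_i` of the differents. [cite: Mochizuki2012, IUTchIV Prop. 1.1 p. 9] -/
theorem norm_dEquiv_purePacket_inv_generators (δ : Π i, Valued.integer (k i))
    (hδ : ∀ i, different p (k i) = Ideal.span {δ i}) (J : DIdx p k) :
    ‖dEquiv p k (purePacket p k fun i => ((δ i : k i))⁻¹) J‖ = (p : ℝ) ^ dSum p k := by
  have hp0 : (0 : ℝ) < p := by exact_mod_cast (Fact.out : p.Prime).pos
  rw [psi_purePacket_apply, norm_prod, dSum, Real.rpow_sum_of_pos hp0]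
  refine Finset.prod_congr rfl fun i _ => ?_
  rw [norm_factorEmb, norm_inv, norm_eq_rpow_neg_differentOrd p (k i) (hδ i) (generator_ne_zero p (k i) (hδ i)),
    ← Real.rpow_neg hp0.le, neg_neg]

/-- **THE CONDUCTOR CONVERSE.** If `‖ψ_J(w)‖ ≤ p^{−(d_I − d_{L_J})}` at EVERY factor `L_J`, then `w·(R_I)^∼ ⊆ R_I`.
Proof: in the tensor basis `⊗b^{(i)}` of integral bases the coordinates of `w·r` (`r ∈ (R_I)^∼`) are
`Tr_V(w·r·⊗c^{(i)}) = Σ_J Tr_{L_J}(ψ_J(w·⊗δ_i⁻¹)·ψ_J(s))` with `s = r·⊗(δ_i c^{(i)}) ∈ (R_I)^∼` (`δ_i c^{(i)}_j ∈ R_i`,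
the definition of the different) and `‖δ_J·ψ_J(w·⊗δ_i⁻¹)·ψ_J(s)‖ ≤ p^{−d_J}·p^{d_J}·1`, hence integers.
[cite: Mochizuki2012, IUTchIV Prop. 1.1 p. 9] -/
theorem smul_normalizedPacket_subset_integerPacket_of_norm_dEquiv_le {w : PacketAlgebra p k}
    (hw : ∀ J, ‖dEquiv p k w J‖ ≤ (p : ℝ) ^ (-(dSum p k - differentOrd p (DFac p k J)))) :
    w • (normalizedPacket p k : Set (PacketAlgebra p k)) ⊆ (integerPacket p k : Set (PacketAlgebra p k)) := by
  classical
  have hp : p.Prime := Fact.out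
  have hp1 : (1 : ℝ) < p := by exact_mod_cast hp.one_lt
  have hp0 : (0 : ℝ) < p := by linarith
  rintro _ ⟨r, hr, rfl⟩
  change w * r ∈ (integerPacket p k : Set (PacketAlgebra p k))
  rw [SetLike.mem_coe]
  -- integral bases, their trace duals, generators of the differents
  have hbases := fun i => exists_integralBasis (p := p) (k i)
  choose n bZ bQ hb using hbases
  have hduals := fun i => exists_traceDual_basis (p := p) (bQ i)
  choose cQ hcQ using hduals
  have hgen := fun i => exists_different_eq_span p (k i)
  choose δ hδ using hgen
  have hδ0 : ∀ i, (δ i : k i) ≠ 0 := fun i => by exact_mod_cast generator_ne_zero p (k i) (hδ i)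
  refine mem_integerPacket_of_norm_repr_le bZ bQ hb fun J => ?_
  rw [repr_piTensorProduct_eq_trace_mul p k bQ cQ hcQ]
  -- `⊗c^{(i)}_{J_i} = ⊗δ_i⁻¹ · ⊗(δ_i c^{(i)}_{J_i})`
  have hsplit : purePacket p k (fun i => cQ i (J i)) =
      purePacket p k (fun i => ((δ i : k i))⁻¹) * purePacket p k (fun i => (δ i : k i) * cQ i (J i)) := by
    rw [purePacket_mul]
    congr 1
    funext i
    rw [Pi.mul_apply, ← mul_assoc, inv_mul_cancel₀ (hδ0 i), one_mul]
  have hsR : purePacket p k (fun i => (δ i : k i) * cQ i (J i)) ∈ normalizedPacket p k :=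
    integerPacket_le_normalizedPacket p k
      (purePacket_mem_integerPacket p k fun i => norm_mul_le_one_of_traceDual (bZ i) (bQ i) (hb i) (cQ i)
        (hcQ i) (hδ i) (J i))
  set s := r * purePacket p k (fun i => (δ i : k i) * cQ i (J i)) with hsdef
  have hs : s ∈ normalizedPacket p k := mul_mem_normalizedPacket p k hr hsR
  have hprod : w * r * purePacket p k (fun i => cQ i (J i)) =
      (w * purePacket p k (fun i => ((δ i : k i))⁻¹)) * s := by
    rw [hsplit, hsdef]; ring
  rw [hprod, trace_eq_sum_trace_dEquiv]
  refine IsUltrametricDist.norm_sum_le_of_forall_le_of_nonneg zero_le_one fun J' _ => ?_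
  obtain ⟨δJ, hδJ⟩ := exists_different_eq_span p (DFac p k J')
  refine norm_trace_le_one_of_norm_mul_le_one hδJ ?_
  rw [map_mul, Pi.mul_apply, map_mul, Pi.mul_apply, norm_mul, norm_mul, norm_mul,
    norm_dEquiv_purePacket_inv_generators p k δ hδ J',
    norm_eq_rpow_neg_differentOrd p (DFac p k J') hδJ (generator_ne_zero p (DFac p k J') hδJ)]
  have hs1 : ‖dEquiv p k s J'‖ ≤ 1 := norm_dEquiv_le_one_of_mem_normalizedPacket' p k hs J'
  have hwJ := hw J'
  have hpos : 0 < (p : ℝ) ^ dSum p k := Real.rpow_pos_of_pos hp0 _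
  calc (p : ℝ) ^ (-differentOrd p (DFac p k J')) * (‖dEquiv p k w J'‖ * (p : ℝ) ^ dSum p k * ‖dEquiv p k s J'‖)
      ≤ (p : ℝ) ^ (-differentOrd p (DFac p k J')) *
          ((p : ℝ) ^ (-(dSum p k - differentOrd p (DFac p k J'))) * (p : ℝ) ^ dSum p k * 1) := by
        gcongr
    _ = 1 := by
        rw [mul_one, ← Real.rpow_add hp0, ← Real.rpow_add hp0]
        ring_nf
        exact Real.rpow_zero _

/-- **THE CONDUCTOR OF `R_I`.**  `w·(R_I)^∼ ⊆ R_I ⟺ ‖ψ_J(w)‖ ≤ p^{−(d_I − d_{L_J})}` at every factor `L_J` (abc-iut-w6-d018's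
sharp converse and §2). [cite: Mochizuki2012, IUTchIV Prop. 1.1 p. 9] -/
theorem smul_normalizedPacket_subset_integerPacket_iff (w : PacketAlgebra p k) :
    w • (normalizedPacket p k : Set (PacketAlgebra p k)) ⊆ (integerPacket p k : Set (PacketAlgebra p k)) ↔
      ∀ J, ‖dEquiv p k w J‖ ≤ (p : ℝ) ^ (-(dSum p k - differentOrd p (DFac p k J))) :=
  ⟨fun h J => norm_dEquiv_le_of_smul_normalizedPacket_subset p k h J,
    smul_normalizedPacket_subset_integerPacket_of_norm_dEquiv_le p k⟩

end Conductor

/-! ## 3. The log-shell versions: inner balls suffice, trace-dual test elements are necessary -/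

section LogShell

variable (p : ℕ) [Fact p.Prime]
variable {I : Type} [Fintype I] [DecidableEq I] [Nonempty I]
variable (k : I → Type) [∀ i, NontriviallyNormedField (k i)] [∀ i, NormedAlgebra ℚ_[p] (k i)]
  [∀ i, IsUltrametricDist (k i)] [∀ i, ProperSpace (k i)]

omit [DecidableEq I] [Nonempty I] in
/-- **`Tr_{V/ℚ_p}(a·⊗y_i) ∈ ℤ_p` for `a ∈ log_p(R_I^×)` and trace-dual test elements `y_i` of the factor shells**
(`Tr_{k_i}(y_i·log_p(R_i^×)) ⊆ ℤ_p`): on generators `Tr(⊗(z_i y_i)) = ∏ Tr_{k_i}(z_i y_i)`, then additivity.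
[cite: Mochizuki2012, IUTchIV Prop. 1.2 (i) p. 10] -/
theorem norm_trace_mul_purePacket_le_one_of_mem_logPacket {y : Π i, k i}
    (hy : ∀ i, ∀ z ∈ logUnits (k i), ‖Algebra.trace ℚ_[p] (k i) (y i * z)‖ ≤ 1)
    {a : PacketAlgebra p k} (ha : a ∈ logPacket p k) :
    ‖Algebra.trace ℚ_[p] (PacketAlgebra p k) (a * purePacket p k y)‖ ≤ 1 := by
  induction ha using AddSubgroup.closure_induction with
  | mem t ht =>
    obtain ⟨z, hz, rfl⟩ := ht
    rw [purePacket_mul, trace_purePacket, norm_prod]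
    refine Finset.prod_le_one (fun i _ => norm_nonneg _) fun i _ => ?_
    rw [Pi.mul_apply, mul_comm]
    exact hy i (z i) (hz i)
  | zero => rw [zero_mul, map_zero, norm_zero]; exact zero_le_one
  | add a b _ _ ha hb =>
    rw [add_mul, map_add]
    exact (IsUltrametricDist.norm_add_le_max _ _).trans (max_le ha hb)
  | neg a _ ha => rwa [neg_mul, map_neg, norm_neg]

omit [Fintype I] [DecidableEq I] [Nonempty I] [∀ i, IsUltrametricDist (k i)] [∀ i, ProperSpace (k i)] in
/-- `⊗c_i · R_I ⊆ log_p(R_I^×)` when every `c_i·R_i ⊆ log_p(R_i^×)` (inner balls of the factor shells).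
[cite: Mochizuki2012, IUTchIV Prop. 1.2 (i) p. 10] -/
theorem purePacket_mul_mem_logPacket_of_mem_integerPacket {c : Π i, k i}
    (hc : ∀ i (o : k i), ‖o‖ ≤ 1 → c i * o ∈ logUnits (k i)) {a : PacketAlgebra p k}
    (ha : a ∈ integerPacket p k) : purePacket p k c * a ∈ logPacket p k := by
  refine integerPacket_induction p k (C := fun t => purePacket p k c * t ∈ logPacket p k) ?_ ?_ ?_ ?_ ha
  · intro x hx
    rw [purePacket_mul]
    exact AddSubgroup.subset_closure ⟨c * x, fun i => hc i (x i) (hx i), rfl⟩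
  · rw [mul_zero]; exact zero_mem _
  · intro a b ha hb
    rw [mul_add]; exact add_mem ha hb
  · intro a ha
    rw [mul_neg]; exact neg_mem ha

/-- **SUFFICIENCY (inner balls).** If `c_i·R_i ⊆ log_p(R_i^×)` (`c_i ≠ 0`) at every factor and
`‖ψ_J(u)‖ ≤ p^{−(d_I − d_{L_J})}·∏_i ‖c_i‖` at every factor `L_J`, then `u·(R_I)^∼ ⊆ log_p(R_I^×)`:
`u = ⊗c_i·u'` with `u'` in the conductor (§2), and `⊗c_i·R_I ⊆ log_p(R_I^×)`.
[cite: Mochizuki2012, IUTchIV Prop. 1.1 p. 9, Prop. 1.2 (i) p. 10] -/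
theorem smul_normalizedPacket_subset_logPacket_of_norm_dEquiv_le {c : Π i, k i} (hc0 : ∀ i, c i ≠ 0)
    (hc : ∀ i (o : k i), ‖o‖ ≤ 1 → c i * o ∈ logUnits (k i)) {u : PacketAlgebra p k}
    (hu : ∀ J, ‖dEquiv p k u J‖ ≤ (p : ℝ) ^ (-(dSum p k - differentOrd p (DFac p k J))) * ∏ i, ‖c i‖) :
    u • (normalizedPacket p k : Set (PacketAlgebra p k)) ⊆ (logPacket p k : Set (PacketAlgebra p k)) := by
  rintro _ ⟨r, hr, rfl⟩
  change u * r ∈ (logPacket p k : Set (PacketAlgebra p k))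
  rw [SetLike.mem_coe]
  set u' := purePacket p k c⁻¹ * u with hu'def
  have hprodpos : 0 < ∏ i, ‖c i‖ := Finset.prod_pos fun i _ => norm_pos_iff.mpr (hc0 i)
  have hu' : ∀ J, ‖dEquiv p k u' J‖ ≤ (p : ℝ) ^ (-(dSum p k - differentOrd p (DFac p k J))) := by
    intro J
    rw [hu'def, map_mul, Pi.mul_apply, norm_mul, psi_purePacket_apply, norm_prod]
    simp_rw [Pi.inv_apply, norm_factorEmb, norm_inv]
    rw [Finset.prod_inv_distrib]
    calc (∏ i, ‖c i‖)⁻¹ * ‖dEquiv p k u J‖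
        ≤ (∏ i, ‖c i‖)⁻¹ * ((p : ℝ) ^ (-(dSum p k - differentOrd p (DFac p k J))) * ∏ i, ‖c i‖) := by
          gcongr
          exact hu J
      _ = (p : ℝ) ^ (-(dSum p k - differentOrd p (DFac p k J))) := by
          field_simp
  have hmem : u' * r ∈ integerPacket p k :=
    smul_normalizedPacket_subset_integerPacket_of_norm_dEquiv_le p k hu' (Set.smul_mem_smul_set hr)
  have hur : u * r = purePacket p k c * (u' * r) := by
    rw [hu'def, ← mul_assoc, ← mul_assoc, purePacket_mul_inv p k hc0, one_mul]
  rw [hur]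
  exact purePacket_mul_mem_logPacket_of_mem_integerPacket p k hc hmem

/-- **NECESSITY (trace-dual test elements).** If `u·(R_I)^∼ ⊆ log_p(R_I^×)` then for every family of trace-dual test
elements `y_i` of the factor shells (`Tr_{k_i}(y_i·log_p(R_i^×)) ⊆ ℤ_p`) and every factor `L_J`:
`‖ψ_J(u)‖·∏_i ‖y_i‖ ≤ p^{d_{L_J}}` (abc-iut-w6-d018's test: `x = ψ⁻¹(0,…,o,…,0) ∈ (R_I)^∼`, so
`Tr_V(u·x·⊗y_i) = Tr_{L_J}(ψ_J(u·⊗y_i)·o) ∈ ℤ_p` for all `o ∈ O_{L_J}`, i.e. `ψ_J(u·⊗y_i) ∈ 𝔇_{L_J}⁻¹`).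
[cite: Mochizuki2012, IUTchIV Prop. 1.1 p. 9] -/
theorem norm_dEquiv_mul_prod_le_of_smul_normalizedPacket_subset_logPacket {u : PacketAlgebra p k}
    (hu : u • (normalizedPacket p k : Set (PacketAlgebra p k)) ⊆ (logPacket p k : Set (PacketAlgebra p k)))
    {y : Π i, k i} (hy : ∀ i, ∀ z ∈ logUnits (k i), ‖Algebra.trace ℚ_[p] (k i) (y i * z)‖ ≤ 1)
    (J : DIdx p k) :
    ‖dEquiv p k u J‖ * ∏ i, ‖y i‖ ≤ (p : ℝ) ^ differentOrd p (DFac p k J) := by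
  classical
  have hp : p.Prime := Fact.out
  have hp1 : (1 : ℝ) < p := by exact_mod_cast hp.one_lt
  have hp0 : (0 : ℝ) < p := by linarith
  obtain ⟨δJ, hδJ⟩ := exists_different_eq_span p (DFac p k J)
  have key : ∀ o : DFac p k J, ‖o‖ ≤ 1 →
      ‖Algebra.trace ℚ_[p] (DFac p k J) (dEquiv p k (u * purePacket p k y) J * o)‖ ≤ 1 := by
    intro o ho
    set x := (dEquiv p k).symm (Pi.single J o) with hxdef
    have hx : x ∈ normalizedPacket p k := dEquiv_symm_single_mem_normalizedPacket p k J ho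
    have hux : u * x ∈ logPacket p k := hu (Set.smul_mem_smul_set hx)
    have htr := norm_trace_mul_purePacket_le_one_of_mem_logPacket p k hy hux
    rw [trace_eq_sum_trace_dEquiv] at htr
    have hvan : ∀ J', J' ≠ J → dEquiv p k (u * x * purePacket p k y) J' = 0 := by
      intro J' hJ'
      rw [map_mul, map_mul, hxdef, AlgEquiv.apply_symm_apply, Pi.mul_apply, Pi.mul_apply,
        Pi.single_eq_of_ne hJ', mul_zero, zero_mul]
    have hat : dEquiv p k (u * x * purePacket p k y) J = dEquiv p k (u * purePacket p k y) J * o := by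
      rw [map_mul, map_mul, hxdef, AlgEquiv.apply_symm_apply, Pi.mul_apply, Pi.mul_apply,
        Pi.single_eq_same, map_mul, Pi.mul_apply]
      ring
    rw [Fintype.sum_eq_single J (fun J' hJ' => by rw [hvan J' hJ', map_zero]), hat] at htr
    exact htr
  have hz := norm_mul_le_one_of_forall_norm_trace_mul_le_one hδJ key
  have hnormy : ‖dEquiv p k (purePacket p k y) J‖ = ∏ i, ‖y i‖ := by
    rw [psi_purePacket_apply, norm_prod]
    simp_rw [norm_factorEmb]
  have hnormJ : ‖(δJ : DFac p k J)‖ = (p : ℝ) ^ (-differentOrd p (DFac p k J)) :=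
    norm_eq_rpow_neg_differentOrd p (DFac p k J) hδJ (generator_ne_zero p (DFac p k J) hδJ)
  rw [map_mul, Pi.mul_apply, norm_mul, norm_mul, hnormy, hnormJ, Real.rpow_neg hp0.le] at hz
  rwa [inv_mul_le_iff₀ (Real.rpow_pos_of_pos hp0 _), mul_one] at hz

end LogShell

end Literature.IUT.LogVolume

end
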